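import Literature.Geometry.Riemannian.HamiltonCurvatureODE
import Literature.Geometry.Riemannian.ChangGurskyYangProofs
import Summits.SmoothPoincare4.SmoothPoincare4.Theses.EntropyRung
import HarnessLib

/-!
# Sketch — crux-ideate `stmt-SmoothPoincare4-10834` (`EntropyRung.ChangGurskyYang`), ideator 1, round 1

First lemmas of the idea cards, stated over existing declarations (not proved here).
-/

noncomputable section

open scoped Manifold ContDiff Matrix BigOperators
open Set

namespace Summit.SmoothPoincare4.SmoothPoincare4.Cruxes.ChangGurskyYang.IdeaSketch

open Literature.Geometry.Riemannian
open Literature.Geometry.Riemannian.HamiltonODE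

/-! ## Card `margerin-cone-hamilton-rails` -/

/-- Frobenius square norm of a `3 × 3` block. -/
def frobSq (X : Matrix (Fin 3) (Fin 3) ℝ) : ℝ := ∑ i, ∑ j, X i j ^ 2

/-- Scalar curvature of a block triple `(A, B, C)` in the tree's normalisation
(`tr A = tr C = R/2`, `ChangGurskyYangPIC.lean`): `R = tr A + tr C`. -/
def scal (p : Blocks) : ℝ := p.1.trace + p.2.2.trace

/-- `|Rm|²` in the `(0,4)`-norm: `‖A‖² + 2‖B‖² + ‖C‖²` (the tree's blocks are the matrix of `Rm`
in the bases `φᵢ, ψᵢ` of norm `√2`, so `|Rm|²_{(0,4)} = 4‖Rm‖²_{End Λ²} = ‖A‖² + 2‖B‖² + ‖C‖²`;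
cf. `|W|²_{(0,4)} = ‖Å‖² + ‖C̊‖²`, `ChangGurskyYangWeylBudget.lean`). -/
def rmNormSq (p : Blocks) : ℝ := frobSq p.1 + 2 * frobSq p.2.1 + frobSq p.2.2

/-- Margerin's deviation `|𝒟|² = |W|² + 2|E|² = |Rm|² − R²/6` (CGY 2003 (0.2); Margerin 1998, Part I). -/
def devNormSq (p : Blocks) : ℝ := rmNormSq p - scal p ^ 2 / 6

/-- **Margerin's closed weak-pinching cone `WP ≤ c`** in Hamilton's block coordinates, cut down to
the Bianchi/symmetry locus: `A, C` symmetric, `tr A = tr C`, `R ≥ 0`, `|𝒟|² ≤ c R²`.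
For `c = 1/6` this is the round cone of half-angle `45°` about the identity ray:
`|Rm|² ≤ R²/3 = 2 · |(R/12) g∘g|²`. -/
def margerinCone (c : ℝ) : Set Blocks :=
  {p | p.1.IsSymm ∧ p.2.2.IsSymm ∧ p.1.trace = p.2.2.trace ∧ 0 ≤ scal p ∧
    devNormSq p ≤ c * scal p ^ 2}

/-- Weighted pairing `⟨A,A'⟩ + 2⟨B,B'⟩ + ⟨C,C'⟩` (the `(0,4)`-inner product of curvature operators). -/
def pairing (p q : Blocks) : ℝ :=
  (∑ i, ∑ j, p.1 i j * q.1 i j) + 2 * (∑ i, ∑ j, p.2.1 i j * q.2.1 i j) + ∑ i, ∑ j, p.2.2 i j * q.2.2 i j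

/-- **Margerin's fundamental polynomial at `β = 2`, ODE level**: `margerinP2 p = 2·R³·(d/dt) WP`
along `p' = field p`, since `(d/dt)|𝒟|² = 2⟨p, p'⟩ − R R'/3`, `(d/dt) R² = 2 R R'`,
`R' = scal (field p) = (tr A)² + (tr C)² + 2‖B‖² = 2|Ric|²`. A cubic×quadratic polynomial in the
21 block entries. -/
def margerinP2 (p : Blocks) : ℝ :=
  scal p * (2 * pairing p (field p) - scal p * scal (field p) / 3) - 2 * devNormSq p * scal (field p)

/-- FIRST LEMMA, pointwise polynomial form (Margerin 1998, Prop. 4 at `β = 2`: "the fundamental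
polynomial `P₂(R)` is non-positive on `1/6`-weakly pinched curvature tensors"): on the closed
`45°` cone, weak pinching does not increase along Hamilton's ODE. Equivalent to
`first_margerinCone_invariant` for all `c ≤ 1/6` at once (barrier lemma
`HamiltonODEMinBarrier`); in the linearised coordinates `A = 1 + α`, `C = 1 + γ`, `b = B` of the
card it is the cubic inequality `Φ_c ≥ 0`. -/
theorem first_margerinP2_nonpos (p : Blocks) (hp : p ∈ margerinCone (1 / 6)) :
    margerinP2 p ≤ 0 := by
  sorry

/-- FIRST LEMMA of card `margerin-cone-hamilton-rails` (= Margerin 1998, Prop. 4 at `β = 2`, read at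
the level of Hamilton's curvature ODE `M' = M² + M^#`): for every `0 ≤ c ≤ 1/6` the weak-pinching
cone `WP ≤ c` is forward invariant under `HamiltonODE.field`.  Finite-dimensional real algebraic
geometry (Margerin 1998, Parts II–V, "the heart of the paper"); kit falsifier: job j008113. -/
theorem first_margerinCone_invariant (c : ℝ) (hc₀ : 0 ≤ c) (hc : c ≤ 1 / 6) :
    IsInvariant field (fun _ ↦ margerinCone c) := by
  sorry

/-- Second rung (Margerin 1998, Prop. 4 in full: `β`-weak pinching `|𝒟|² ≤ K R^β`, `β ∈ [β₀(c), 2]`,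
is preserved inside `WP ≤ c < 1/6`) — the improving pinching sets; each is closed, convex
(hypograph of the concave `R ↦ √K R^{β/2}`) and `B ↦ −B` symmetric, as
`hamilton_maximumPrinciple_curvatureODE` requires. -/
theorem second_margerin_beta_pinching (c : ℝ) (hc₀ : 0 ≤ c) (hc : c < 1 / 6) :
    ∃ β₀ : ℝ, β₀ < 2 ∧ ∀ β ∈ Icc β₀ 2, ∀ K : ℝ, 0 ≤ K →
      IsInvariant field (fun _ ↦ margerinCone c ∩ {p | devNormSq p ≤ K * scal p ^ β}) := by
  sorry

/-- The shape in which the card re-delivers `hMargerin` of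
`changGurskyYang_sphere_four_of_chernGaussBonnet_of_margerin_of_thm14` from the two rungs above, the
shared convergence node (H1/5.2 of the PCO programme) and Killing–Hopf (`killingHopf_quotient_four`,
proved): statement only, to fix the interface. -/
def MargerinLeaf : Prop :=
  ∀ (M : Type) [TopologicalSpace M] [T2Space M] [SecondCountableTopology M]
    [ChartedSpace (EuclideanSpace ℝ (Fin 4)) M] [IsManifold (𝓡 4) ∞ M] [CompactSpace M]
    [ConnectedSpace M]
    (g : Literature.Geometry.Lorentzian.PseudoRiemannianMetric (𝓡 4) ∞ (EuclideanSpace ℝ (Fin 4))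
      (TangentSpace (𝓡 4) : M → Type _))
    [g.HasLeviCivita], g.IsRiemannian → (∀ x, 0 < g.scalarCurvature x) →
    (∀ x, g.weakPinching x < 1 / 6) →
    Nonempty (M ≃ₘ⟮𝓡 4, 𝓡 4⟯ Metric.sphere (0 : EuclideanSpace ℝ (Fin 5)) 1) ∨
      Literature.Topology.FourManifolds.IsRealProjectiveSpace 4 M

/-- Interface check: `MargerinLeaf` is literally hypothesis `hMargerin` of the tree's reduction, so the
crux follows from it plus the two other leaves (`hCGB`, `hThm14`) and `Iff.rfl` with the named fact. -/
example (hM : MargerinLeaf)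
    (hCGB : ∀ (M : Type) [TopologicalSpace M] [T2Space M] [SecondCountableTopology M]
      [ChartedSpace (EuclideanSpace ℝ (Fin 4)) M] [IsManifold (𝓡 4) ∞ M] [CompactSpace M]
      [SimplyConnectedSpace M]
      (g : Literature.Geometry.Lorentzian.PseudoRiemannianMetric (𝓡 4) ∞ (EuclideanSpace ℝ (Fin 4))
        (TangentSpace (𝓡 4) : M → Type _))
      [g.HasLeviCivita], g.IsRiemannian →
      ∃ χ : ℕ, 2 ≤ χ ∧
        8 * Real.pi ^ 2 * χ = 1 / 4 * g.weylEnergy.toReal + g.sigma2WeylSchoutenIntegral)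
    (hThm14 : ∀ (M : Type) [TopologicalSpace M] [T2Space M] [SecondCountableTopology M]
      [ChartedSpace (EuclideanSpace ℝ (Fin 4)) M] [IsManifold (𝓡 4) ∞ M] [CompactSpace M]
      [MeasurableSpace M] [BorelSpace M]
      (g₀ : Literature.Geometry.Lorentzian.PseudoRiemannianMetric (𝓡 4) ∞ (EuclideanSpace ℝ (Fin 4))
        (TangentSpace (𝓡 4) : M → Type _))
      [g₀.HasLeviCivita] (hg₀ : g₀.IsRiemannian),
      0 < yamabeConstant (g₀.toContMDiffRiemannianMetric hg₀) →
      1 / 4 * g₀.weylEnergy.toReal < g₀.sigma2WeylSchoutenIntegral →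
      ∃ (g : Literature.Geometry.Lorentzian.PseudoRiemannianMetric (𝓡 4) ∞ (EuclideanSpace ℝ (Fin 4))
          (TangentSpace (𝓡 4) : M → Type _))
        (_ : g.HasLeviCivita) (hg : g.IsRiemannian),
        IsConformalTo (g.toContMDiffRiemannianMetric hg) (g₀.toContMDiffRiemannianMetric hg₀) ∧
        ∀ x, 1 / 4 * g.weylNormSq x < g.sigma2WeylSchouten x) :
    Summit.SmoothPoincare4.SmoothPoincare4.Theses.EntropyRung.ChangGurskyYang :=
  changGurskyYang_sphere_four_of_margerin_of_chernGaussBonnet_of_thm14 hM hCGB hThm14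

end Summit.SmoothPoincare4.SmoothPoincare4.Cruxes.ChangGurskyYang.IdeaSketch

end
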